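import Mathlib

/-!
# `RestartPrinciple` (stmt-AtomisticToContinuum-12503): the quantifier prefix of its antecedent is
# not restartable — schema (non-)entailments

Negative-side lemmas of the standing disprover (`Cruxes/RestartPrinciple/Disproof.lean` §3), route
`RelayRaceLocality`. The crux is literally `S → G` with
`S` = short-time guarded hydrodynamic limit from local-Gibbs TIME-0 data, prefix
`∃ η₀ ∀ M ∃ τ₁ ∀ profile ∃ σ₀ ∀ σ < σ₀`, and `G` = the packing-guarded conjunct (stmt-3093 body).
Abstracting "the LLN holds at time `t` (at reduced density `σ`)" to a predicate `L` and the `C³` size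
of the classical solution to a function `size` (finite at every time before the first shock, unbounded
at it), the two defects of `S` as a restart hypothesis become theorems with explicit witnesses:

* `anchored_schema_false` — TIME-0 ANCHORING: a short-time statement restarting only from time `0`
  entails nothing beyond its horizon `τ₁` (witness `L t := t < 1`);
* `prefixMfirst_schema_false` — PREFIX: even an honest RESTARTABLE short-time statement with `S`'s
  prefix (`σ₀` chosen under `∀ M`) does not entail the `G`-shape `∃ σ₀ ∀ σ < σ₀ ∀ t` (witness
  `L σ t := σ * t ≤ 1`, `size σ s := s`);
* `restart_induction` — the CORRECTED schema (`σ` fixed before `M`, restart from any `s₀ ≥ 0`, size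
  finite at every time) does entail it, by a finite induction over the grid `k · τ₁ / 2`; this is the
  abstract form of the bookkeeping of line `Sketch` (`stub_restartableHL` = `hstep`,
  `stub_finiteSize` = `hsize`).

Consequence for provers: no proof of the crux can consume `S` as a black box; its content is a
re-proof of the short-time limit in the corrected (restartable) currency.
refuter-cdisprove-stmt-AtomisticToContinuum-12503-0, 2026-08-16.
-/

namespace Summit.AtomisticToContinuum.HydrodynamicLimit.Theorems.RestartPrincipleNegative

open Set

/-- RESTART DEFECT (time-0 anchoring): a short-time statement that only restarts from time `0`
entails nothing beyond `τ₁`. Witness `L t := t < 1`, `τ₁ := 1`. -/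
theorem anchored_schema_false :
    ¬ ∀ L : ℝ → Prop, (∃ τ₁ : ℝ, 0 < τ₁ ∧ (L 0 → ∀ t ∈ Ico (0 : ℝ) τ₁, L t)) →
        (L 0 → ∀ t : ℝ, 0 ≤ t → L t) := by
  intro h
  have h1 : (1 : ℝ) < 1 :=
    h (fun t => t < 1) ⟨1, one_pos, fun _ t ht => ht.2⟩ (by norm_num) 1 zero_le_one
  exact lt_irrefl _ h1

/-- PREFIX DEFECT (`σ₀` under `∀ M`): a restartable short-time statement (restart from any `s₀ ≥ 0`)
with the prefix `∀ M ∃ τ₁ ∃ σ₀ ∀ σ < σ₀`, together with finiteness of the size at every time, does NOT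
entail `∃ σ₀ ∀ σ < σ₀, L σ 0 → ∀ t ≥ 0, L σ t`. Witness: `L σ t := σ * t ≤ 1` (LLN up to time `σ⁻¹`),
`size σ s := s`. -/
theorem prefixMfirst_schema_false :
    ¬ ∀ (L : ℝ → ℝ → Prop) (size : ℝ → ℝ → ℝ),
      (∀ M : ℝ, 0 < M → ∃ τ₁ : ℝ, 0 < τ₁ ∧ ∃ σ₀ : ℝ, 0 < σ₀ ∧ ∀ σ : ℝ, 0 < σ → σ < σ₀ →
          ∀ s₀ : ℝ, 0 ≤ s₀ → L σ s₀ → ∀ t ∈ Ico s₀ (s₀ + τ₁),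
            (∀ s ∈ Icc 0 t, size σ s ≤ M) → L σ t) →
      (∀ σ t : ℝ, ∃ M : ℝ, 0 < M ∧ ∀ s ∈ Icc 0 t, size σ s ≤ M) →
      ∃ σ₀ : ℝ, 0 < σ₀ ∧ ∀ σ : ℝ, 0 < σ → σ < σ₀ → L σ 0 → ∀ t : ℝ, 0 ≤ t → L σ t := by
  intro h
  have hS : ∀ M : ℝ, 0 < M → ∃ τ₁ : ℝ, 0 < τ₁ ∧ ∃ σ₀ : ℝ, 0 < σ₀ ∧ ∀ σ : ℝ, 0 < σ → σ < σ₀ →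
      ∀ s₀ : ℝ, 0 ≤ s₀ → σ * s₀ ≤ 1 → ∀ t ∈ Ico s₀ (s₀ + τ₁),
        (∀ s ∈ Icc 0 t, s ≤ M) → σ * t ≤ 1 := by
    intro M hM
    refine ⟨1, one_pos, 1 / (M + 1), by positivity, fun σ hσ hσlt s₀ hs₀ _ t ht hguard => ?_⟩
    have htM : t ≤ M := hguard t ⟨hs₀.trans ht.1, le_rfl⟩
    have h1 : σ * (M + 1) < 1 := by rwa [lt_div_iff₀ (by positivity)] at hσlt
    have h2 : σ * t ≤ σ * M := mul_le_mul_of_nonneg_left htM hσ.le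
    have h3 : σ * (M + 1) = σ * M + σ := by ring
    linarith
  have hsize : ∀ σ t : ℝ, ∃ M : ℝ, 0 < M ∧ ∀ s ∈ Icc 0 t, s ≤ M := fun σ t =>
    ⟨max t 1, lt_max_of_lt_right one_pos, fun s hs => hs.2.trans (le_max_left t 1)⟩
  obtain ⟨σ₀, hσ₀, hG⟩ := h (fun σ t => σ * t ≤ 1) (fun _ s => s) hS hsize
  have hσ : 0 < σ₀ / 2 := half_pos hσ₀
  have h0 : σ₀ / 2 * 0 ≤ 1 := by norm_num
  have hbad : σ₀ / 2 * (4 / σ₀) ≤ 1 := hG (σ₀ / 2) hσ (half_lt_self hσ₀) h0 (4 / σ₀) (by positivity)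
  have hval : σ₀ / 2 * (4 / σ₀) = 2 := by field_simp; ring
  linarith

/-- THE CORRECTED SCHEMA HOLDS (`σ` fixed, restart from any `s₀ ≥ 0`, size finite at every time):
finite restart induction over the grid `k · τ₁ / 2`. -/
theorem restart_induction (L : ℝ → Prop) (size : ℝ → ℝ)
    (hstep : ∀ M : ℝ, 0 < M → ∃ τ₁ : ℝ, 0 < τ₁ ∧ ∀ s₀ : ℝ, 0 ≤ s₀ → L s₀ →
        ∀ t ∈ Ico s₀ (s₀ + τ₁), (∀ s ∈ Icc 0 t, size s ≤ M) → L t)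
    (hsize : ∀ t : ℝ, ∃ M : ℝ, 0 < M ∧ ∀ s ∈ Icc 0 t, size s ≤ M)
    (h0 : L 0) : ∀ t : ℝ, 0 ≤ t → L t := by
  intro t ht
  obtain ⟨M, hM, hsz⟩ := hsize t
  obtain ⟨τ₁, hτ₁, hst⟩ := hstep M hM
  have key : ∀ n : ℕ, ∀ s : ℝ, 0 ≤ s → s ≤ t → s ≤ n * (τ₁ / 2) → L s := by
    intro n
    induction n with
    | zero =>
      intro s hs0 _ hsn
      have hs : s = 0 := le_antisymm (by simpa using hsn) hs0
      subst hs
      exact h0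
    | succ n ih =>
      intro s hs0 hst' hsn
      by_cases hc : s ≤ n * (τ₁ / 2)
      · exact ih s hs0 hst' hc
      · push Not at hc
        have hs₀ : 0 ≤ (n : ℝ) * (τ₁ / 2) := by positivity
        refine hst _ hs₀ (ih _ hs₀ (hc.le.trans hst') le_rfl) s ⟨hc.le, ?_⟩ ?_
        · have hcast : ((n + 1 : ℕ) : ℝ) * (τ₁ / 2) = n * (τ₁ / 2) + τ₁ / 2 := by push_cast; ring
          linarith
        · intro s' hs'
          exact hsz s' ⟨hs'.1, hs'.2.trans hst'⟩
  obtain ⟨n, hn⟩ := exists_nat_ge (t / (τ₁ / 2))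
  exact key n t ht le_rfl (by rwa [div_le_iff₀ (half_pos hτ₁)] at hn)

end Summit.AtomisticToContinuum.HydrodynamicLimit.Theorems.RestartPrincipleNegative
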